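import Mathlib.MeasureTheory.Constructions.BorelSpace.Basic
import Mathlib.MeasureTheory.Measure.ProbabilityMeasure
import Mathlib.MeasureTheory.Measure.Dirac
import Mathlib.MeasureTheory.Function.L2Space
import Literature.Analysis.FluidPDE.LerayProjector
import Literature.Analysis.FunctionSpaces.TorusSobolevSpace
import Literature.Analysis.FunctionSpaces.TorusFluidGlue
import Literature.Analysis.FunctionSpaces.TorusCalculus
import HarnessLib

-- provenance: harness21/H21/H21/Prelude/FluidKinetic/StatisticalSolution.lean @ d549e1a (interim HEAD d8f2665); M5 mechanical rewrite
/-!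
# Stationary statistical solutions of the Navier–Stokes equations on `T^d`

Trunk: FluidKinetic (outline `H21/Outlines/FluidKinetic.md`, item F12 `StatisticalSolution`;
notions `stationary_statistical_solution`, `long_time_and_ensemble_averages`).

A *stationary statistical solution* of the (space-periodic, mean-zero) Navier–Stokes equations
with viscosity `ν` and forcing `f` is a Borel probability measure `μ` on the energy space
`H = Torus.energySpace d` (Constantin–Foias' `H`) such that (Foias 1972–73; Foias–Manley–Rosa–Temam
2001, Ch. IV, Def. 1.3, (1.29)–(1.31); equation numbers below follow the printed book):

* `∫ ‖u‖_V² dμ(u) < ∞` (finite mean enstrophy),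
* `∫ ⟨F(u), Φ'(u)⟩ dμ(u) = 0` for every cylindrical test functional `Φ`, where
  `F(u) = f − νAu − B(u,u)` (a stationary Liouville / Hopf equation),
* the energy inequality `∫_{e₁ ≤ |u|² < e₂} (ν‖u‖_V² − (f,u)) dμ(u) ≤ 0` on every energy shell.

## Contents

* `Literature.Analysis.FluidPDE.Torus.instMeasurableSpaceEnergySpace`, `Literature.Analysis.FluidPDE.Torus.instBorelSpaceEnergySpace` — the Borel
  σ-algebra on `H`.
* `Literature.Torus.pairing u g = ∫ ⟪u, g⟫` — the `L²` pairing of an `L²` class with a field.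
* `Literature.Torus.CylindricalTest d` — cylindrical test functionals `Φ(u) = φ((u,g₁),…,(u,gₘ))`, with
  `CylindricalTest.coords`, `CylindricalTest.eval`, `CylindricalTest.grad` (`Φ'(u)`, a smooth
  solenoidal field).
* `Literature.Torus.inertialPairing u w = ∫ (u ⊗ u) : ∇w = −b(u,u,w)`,
  `Literature.Torus.nsGeneratorPairing ν f u w = ⟨F(u), w⟩` (all derivatives on the smooth `w`).
* `Literature.Torus.IsStationaryStatisticalSolution ν f μ` (FMRT IV Def. 1.3).
* `Literature.Analysis.FluidPDE.Torus.ensembleAverage`, `ensembleEnergy`, `ensembleEnstrophy`, `ensembleDissipation`,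
  `Literature.Analysis.FluidPDE.Torus.IsTimeAverageMeasure`, `Literature.Analysis.FluidPDE.Torus.IsSteadyWeakSolution`.
* Theorems (literature, sorried): `IsStationaryStatisticalSolution.energy_le`,
  `IsStationaryStatisticalSolution.energy_eq` (energy equation, `d = 2`, FMRT IV §2),
  `isStationaryStatisticalSolution_dirac`, `ensembleDissipation_le_of_isStationary`.

## Mathlib search

Mathlib (this pin) has `borel`/`BorelSpace`, `IsProbabilityMeasure`, `Measure.dirac`,
`lintegral`, `ContDiff`, `HasCompactSupport`, `Bornology.IsBounded`, the Hilbert space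
`Lp E 2 μ`; it has **no** `MeasurableSpace` instance on `MeasureTheory.Lp` or on its subtypes
(grep `MeasurableSpace (Lp` / `BorelSpace (Lp`: nothing; only `WithLp.measurableSpace` on the
finite-dimensional `WithLp p X`), and nothing on statistical solutions
(grep `StatisticalSolution|statistical solution`: nothing). Everything found is used; nothing
is duplicated.

## Design notes

* **Instances (outline §4.11).** `instMeasurableSpaceEnergySpace : MeasurableSpace H := borel H`
  and `instBorelSpaceEnergySpace` are new instances on an H21 type; they override no Mathlib
  instance today. *Potential future diamond:* should Mathlib ever declare
  `MeasurableSpace (Lp E p μ) := borel _`, then `Subtype.instMeasurableSpace` would give a second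
  (propositionally but not definitionally equal) structure on `H`, and these two instances must
  then be **deleted** (and `BorelSpace H` obtained from `Subtype.borelSpace`).
* All space derivatives fall on the smooth test field `w` (`Torus.fderiv`, `Torus.laplacian`),
  so `nsGeneratorPairing ν f u w` is meaningful for every `u ∈ H` (an `L²` class, coerced to a
  representative `T^d → ℝ^d`; the integrals do not depend on the representative).
* `pairing`, `inertialPairing`, `nsGeneratorPairing` are Bochner integrals: **junk value `0`**
  when the integrand is not integrable (e.g. `f ∉ L¹`); theorems add `MemLp f 2` where needed.
* The energy space `H` is mean-zero (accepted `Torus.energySpace`), so cylindrical test fields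
  `gᵢ` are taken smooth, divergence-free **and mean-zero** (`gᵢ ∈ 𝒱`), and `Φ'(u) ∈ 𝒱`.
* `IsTimeAverageMeasure` takes the averaging functional `avg : (ℝ → ℝ) → ℝ` explicitly (e.g. a
  Banach generalized limit `Λ.longTimeAvg` of `Literature.Statements.Turb.Wave0`), applied to bounded
  continuous observables only (no junk on unbounded ones).
* FMRT state the theory for `d = 2, 3`; here `d` is any finite index type. The energy *equation*
  (equality in FMRT IV (1.31)) is stated for `Fintype.card d = 2` only (in `d = 3` only the inequality
  `energy_le` is known); the Dirac example needs `Fintype.card d ≤ 4` (so that `b(u,u,u) = 0`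
  and the weak formulation extends to `w ∈ V` by the Sobolev embedding `H¹ ⊂ L⁴`).

## References

* C. Foias, *Statistical study of Navier–Stokes equations I, II*, Rend. Sem. Mat. Univ. Padova
  48 (1972) 219–348; 49 (1973) 9–123.
* C. Foias, O. Manley, R. Rosa, R. Temam, *Navier–Stokes Equations and Turbulence* (Cambridge
  Univ. Press, 2001), Ch. IV §1 (Def. 1.2–1.3, (1.27)–(1.34)), §2.1 Def. 2.1 and §3.1 (time-average
  measures), §1.3 Def. 1.4 (generalized limits), Ch. V §1 (ensemble averages). Cited as FMRT
  [FMRTTurbulence2001]; locators verified against the printed numbering on 2026-08-15.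
-/

noncomputable section

open MeasureTheory
open scoped InnerProductSpace RealInnerProductSpace ENNReal NNReal

namespace Literature.Analysis.FluidPDE

namespace Torus

variable {d : Type*} [Fintype d] [DecidableEq d]

/-- Local notation for the real Hilbert space `L²(T^d; ℝ^d)`. -/
local notation "L2T " d':max => Lp (EuclideanSpace ℝ d') 2 (volume : Measure (UnitAddTorus d'))

/-! ### The Borel σ-algebra on `H` -/

omit [DecidableEq d] in
/-- The Borel σ-algebra on the energy space `H = Torus.energySpace d` (FMRT 2001, Ch. IV §1.2 with App. A.1:
statistical solutions are Borel probability measures on `H`). A new instance on an H21 type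
(outline §4.11): Mathlib has no `MeasurableSpace` instance on `MeasureTheory.Lp` or its
subtypes. **If Mathlib ever puts `borel` on `Lp`, this instance creates a diamond with
`Subtype.instMeasurableSpace` and must be deleted.**
[cite: FMRTTurbulence2001, Ch. IV §1.2 with App. A.1 (probability measures on H are Borel measures)] -/
instance instMeasurableSpaceEnergySpace : MeasurableSpace (FunctionSpaces.Torus.energySpace d) := borel _

omit [DecidableEq d] in
/-- The σ-algebra `Torus.instMeasurableSpaceEnergySpace` on `H` is the Borel one (by definition;
FMRT 2001, Ch. IV §1.2 / App. A.1). To be deleted together with `instMeasurableSpaceEnergySpace` should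
Mathlib acquire a `BorelSpace (Lp E p μ)` instance (outline §4.11).
[cite: FMRTTurbulence2001, Ch. IV §1.2 with App. A.1] -/
instance instBorelSpaceEnergySpace : BorelSpace (FunctionSpaces.Torus.energySpace d) := ⟨rfl⟩

/-! ### Pairings and cylindrical test functionals -/

omit [DecidableEq d] in
/-- The `L²` pairing `(u, g) = ∫_{T^d} ⟪u(x), g(x)⟫ dx` of an `L²` class `u` with a vector field
`g` (FMRT 2001, Ch. IV §1.1: the scalar product `(·,·)` of `H`). Junk value `0` if `⟪u, g⟫` is not
integrable. [cite: FMRTTurbulence2001, Ch. IV §1.1 (the scalar product (·,·) of H)] -/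
def pairing (u : L2T d) (g : UnitAddTorus d → EuclideanSpace ℝ d) : ℝ :=
  ∫ x, ⟪(u : UnitAddTorus d → EuclideanSpace ℝ d) x, g x⟫_ℝ

variable (d) in
/-- A **cylindrical test functional** on `H`: `Φ(u) = φ((u,g₁), …, (u,gₘ))` with
`g₁, …, gₘ ∈ 𝒱` smooth, divergence-free, mean-zero fields and `φ : ℝ^m → ℝ` a compactly
supported `C¹` function (FMRT 2001, Ch. IV §1.2, Def. 1.2 of the class `𝒯` of test
functionals, and Ch. V §1). Bundled as data + axioms.
[cite: FMRTTurbulence2001, Ch. IV §1.2 Def. 1.2 and the cylindrical example after (1.27); Ch. V §1 Def. 1.3] -/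
structure CylindricalTest where
  /-- The number `m` of coordinates. -/
  m : ℕ
  /-- The test fields `g₁, …, gₘ : T^d → ℝ^d`. -/
  g : Fin m → UnitAddTorus d → EuclideanSpace ℝ d
  /-- Each `gᵢ` is smooth. -/
  g_smooth : ∀ i, FunctionSpaces.Torus.IsSmooth (g i)
  /-- Each `gᵢ` is divergence free. -/
  g_divFree : ∀ i, FunctionSpaces.Torus.IsDivFree (g i)
  /-- Each `gᵢ` has zero mean. -/
  g_zeroMean : ∀ i, FunctionSpaces.Torus.HasZeroMean (g i)
  /-- The finite-dimensional profile `φ : ℝ^m → ℝ`. -/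
  φ : EuclideanSpace ℝ (Fin m) → ℝ
  /-- `φ` is `C¹`. -/
  φ_contDiff : ContDiff ℝ 1 φ
  /-- `φ` has compact support. -/
  φ_compact : HasCompactSupport φ

namespace CylindricalTest

/-- The coordinates `((u,g₁), …, (u,gₘ)) ∈ ℝ^m` of `u ∈ H` seen through the cylindrical test
functional `Φ` (FMRT 2001, Ch. IV §1.2, example after (1.27)).
[cite: FMRTTurbulence2001, Ch. IV §1.2, example after (1.27)] -/
def coords (Φ : CylindricalTest d) (u : FunctionSpaces.Torus.energySpace d) : EuclideanSpace ℝ (Fin Φ.m) :=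
  WithLp.toLp 2 fun i => pairing (u : L2T d) (Φ.g i)

/-- The value `Φ(u) = φ((u,g₁), …, (u,gₘ))` of a cylindrical test functional at `u ∈ H`
(FMRT 2001, Ch. IV §1.2, example after (1.27)).
[cite: FMRTTurbulence2001, Ch. IV §1.2, example after (1.27)] -/
def eval (Φ : CylindricalTest d) (u : FunctionSpaces.Torus.energySpace d) : ℝ :=
  Φ.φ (Φ.coords u)

/-- The differential `Φ'(u) = ∑ᵢ ∂ᵢφ((u,g₁), …, (u,gₘ)) gᵢ ∈ 𝒱` of a cylindrical test functional
at `u ∈ H`, a smooth divergence-free mean-zero vector field on `T^d` (FMRT 2001, Ch. IV §1.2, display after (1.27)).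
[cite: FMRTTurbulence2001, Ch. IV §1.2, display after (1.27): Φ'(u) = Σⱼ ∂ⱼψ gⱼ] -/
def grad (Φ : CylindricalTest d) (u : FunctionSpaces.Torus.energySpace d) : UnitAddTorus d → EuclideanSpace ℝ d :=
  fun x => ∑ i, (_root_.fderiv ℝ Φ.φ (Φ.coords u) (EuclideanSpace.single i 1)) • Φ.g i x

/-- `Φ'(u)` is smooth (a finite linear combination of the smooth `gᵢ`). PROVED:
`isSmooth_grad_holds` (`StatisticalSolutionDirac.lean`). [folklore] -/
def isSmooth_grad : Prop :=
  ∀ (Φ : CylindricalTest d) (u : FunctionSpaces.Torus.energySpace d),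
    FunctionSpaces.Torus.IsSmooth (Φ.grad u)

/-- `Φ'(u)` is divergence free (a finite linear combination of the solenoidal `gᵢ`). PROVED:
`isDivFree_grad_holds` (`StatisticalSolutionDirac.lean`). [folklore] -/
def isDivFree_grad : Prop :=
  ∀ (Φ : CylindricalTest d) (u : FunctionSpaces.Torus.energySpace d),
    FunctionSpaces.Torus.IsDivFree (Φ.grad u)

/-- `Φ'(u)` has zero mean (a finite linear combination of the mean-zero `gᵢ`). PROVED:
`hasZeroMean_grad_holds` (`StatisticalSolutionDirac.lean`). [folklore] -/
def hasZeroMean_grad : Prop :=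
  ∀ (Φ : CylindricalTest d) (u : FunctionSpaces.Torus.energySpace d),
    FunctionSpaces.Torus.HasZeroMean (Φ.grad u)

end CylindricalTest

/-! ### The Navier–Stokes generator `⟨F(u), w⟩` -/

omit [DecidableEq d] in
/-- The inertial pairing `∫_{T^d} ⟪∇w(x) u(x), u(x)⟫ dx = ∫ (u ⊗ u) : ∇w = −b(u, u, w)` of an
`L²` class `u` against a smooth field `w`; only `w` is differentiated (`Torus.fderiv`), so this is
meaningful for every `u ∈ L²` with `u ⊗ u ∈ L¹` (FMRT 2001, Ch. II (A.28)/(A.31): the trilinear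
form `b` and `b(u,u,w) = −b(u,w,u)`; Ch. IV (1.7)–(1.9)). Junk value `0` if not integrable.
[cite: FMRTTurbulence2001, Ch. IV §1.1 (1.7)–(1.9) (the trilinear form b and b(u,v,w) = −b(u,w,v))] -/
def inertialPairing (u : L2T d) (w : UnitAddTorus d → EuclideanSpace ℝ d) : ℝ :=
  ∫ x, ⟪FunctionSpaces.Torus.fderiv w x ((u : UnitAddTorus d → EuclideanSpace ℝ d) x),
    (u : UnitAddTorus d → EuclideanSpace ℝ d) x⟫_ℝ

omit [DecidableEq d] in
/-- The Navier–Stokes generator paired with a smooth solenoidal field,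
`⟨F(u), w⟩ = (f, w) + ν (u, Δw) + ∫ (u ⊗ u) : ∇w` where `F(u) = f − νAu − B(u,u)`
(FMRT 2001, Ch. IV (1.11), (1.30)), written with all derivatives on `w` so that it makes sense for
`u ∈ H`. Junk value `0` in each summand whose integrand is not integrable.
[cite: FMRTTurbulence2001, Ch. IV §1.1 (1.11) and §1.2 (1.30) (F(u) = f − νAu − B(u))] -/
def nsGeneratorPairing (ν : ℝ) (f : UnitAddTorus d → EuclideanSpace ℝ d) (u : FunctionSpaces.Torus.energySpace d)
    (w : UnitAddTorus d → EuclideanSpace ℝ d) : ℝ :=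
  (∫ x, ⟪f x, w x⟫_ℝ) +
    ν * (∫ x, ⟪((u : L2T d) : UnitAddTorus d → EuclideanSpace ℝ d) x, FunctionSpaces.Torus.laplacian w x⟫_ℝ) +
      inertialPairing (u : L2T d) w

/-! ### Stationary statistical solutions -/

/-- A **stationary statistical solution** of the space-periodic Navier–Stokes equations with
viscosity `ν` and (time-independent) force `f`: a Borel probability measure `μ` on `H` with
finite mean enstrophy `∫ ‖u‖_V² dμ < ∞` (1.29), satisfying the stationary Liouville equation
`∫ ⟨F(u), Φ'(u)⟩ dμ = 0` for all cylindrical test functionals `Φ` (1.30), and the energy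
inequality `∫_{e₁ ≤ |u|² < e₂} (ν ‖u‖_V² − (f, u)) dμ ≤ 0` for all `0 ≤ e₁ < e₂ ≤ ∞` (1.31)
(Foias 1972, §3; FMRT 2001, Ch. IV Def. 1.3, (1.29)–(1.31)). Here `‖u‖_V² = ‖∇u‖²_{L²}` is
the spectral `Torus.eGradNormSq`. [cite: FoiasPadova1972, §3] -/
structure IsStationaryStatisticalSolution (ν : ℝ) (f : UnitAddTorus d → EuclideanSpace ℝ d)
    (μ : Measure (FunctionSpaces.Torus.energySpace d)) : Prop where
  /-- `μ` is a probability measure. -/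
  prob : IsProbabilityMeasure μ
  /-- Finite mean enstrophy `∫ ‖u‖_V² dμ(u) < ∞` (FMRT IV (1.29)). -/
  enstrophy_finite :
    ∫⁻ u, FunctionSpaces.Torus.eGradNormSq ((u : L2T d) : UnitAddTorus d → EuclideanSpace ℝ d) ∂μ < ∞
  /-- The stationary Liouville equation `∫ ⟨F(u), Φ'(u)⟩ dμ(u) = 0` (FMRT IV (1.30)), with the
  integrand integrable. -/
  generator : ∀ Φ : CylindricalTest d,
    Integrable (fun u => nsGeneratorPairing ν f u (Φ.grad u)) μ ∧
      ∫ u, nsGeneratorPairing ν f u (Φ.grad u) ∂μ = 0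
  /-- The energy inequality on energy shells
  `∫_{e₁ ≤ |u|² < e₂} (ν ‖u‖_V² − (f, u)) dμ(u) ≤ 0` (FMRT IV (1.31)). -/
  energy_ineq : ∀ e₁ e₂ : ℝ≥0∞, e₁ < e₂ →
    ∫ u in {u : FunctionSpaces.Torus.energySpace d | e₁ ≤ ‖u‖ₑ ^ 2 ∧ ‖u‖ₑ ^ 2 < e₂},
      (ν * (FunctionSpaces.Torus.eGradNormSq ((u : L2T d) : UnitAddTorus d → EuclideanSpace ℝ d)).toReal -
        pairing (u : L2T d) f) ∂μ ≤ 0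

/-! ### Ensemble averages and time-average measures -/

omit [DecidableEq d] in
/-- The ensemble average `⟨Ψ⟩_μ = ∫ Ψ(u) dμ(u)` of an observable `Ψ : H → ℝ` with respect to a
(probability) measure `μ` on `H` (FMRT 2001, Ch. V §1.1: ensemble averages). Junk value `0` of
the Bochner integral if `Ψ` is not `μ`-integrable.
[cite: FMRTTurbulence2001, Ch. V §1.1 (ensemble averages)] -/
def ensembleAverage (μ : Measure (FunctionSpaces.Torus.energySpace d)) (Ψ : FunctionSpaces.Torus.energySpace d → ℝ) : ℝ :=
  ∫ u, Ψ u ∂μ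

omit [DecidableEq d] in
/-- The mean energy `e(μ) = ∫ |u|²_{L²} dμ(u)` (twice the mean kinetic energy) of a measure on `H`
(FMRT 2001, Ch. IV (1.32)–(1.34), Ch. V §1). Junk value `0` if not integrable.
[cite: FMRTTurbulence2001, Ch. IV §1.2 (1.32)–(1.34)] -/
def ensembleEnergy (μ : Measure (FunctionSpaces.Torus.energySpace d)) : ℝ :=
  ∫ u, ‖u‖ ^ 2 ∂μ

omit [DecidableEq d] in
/-- The mean enstrophy `∫ ‖u‖_V² dμ(u) = ∫ ‖∇u‖²_{L²} dμ(u) ∈ [0, ∞]` of a measure on `H`, as a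
lower Lebesgue integral of the spectral `Torus.eGradNormSq` (FMRT 2001, Ch. IV (1.28)–(1.29)).
[cite: FMRTTurbulence2001, Ch. IV §1.2 (1.28)–(1.29)] -/
def ensembleEnstrophy (μ : Measure (FunctionSpaces.Torus.energySpace d)) : ℝ≥0∞ :=
  ∫⁻ u, FunctionSpaces.Torus.eGradNormSq ((u : L2T d) : UnitAddTorus d → EuclideanSpace ℝ d) ∂μ

omit [DecidableEq d] in
/-- The mean energy dissipation rate `ε(μ) = ν ∫ ‖∇u‖²_{L²} dμ(u)` of a measure on `H`
(FMRT 2001, Ch. V §1; Doering–Foias 2002, §2, `ε = ν⟨‖∇u‖²⟩`). Junk value `ν * 0` via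
`ENNReal.toReal` when the mean enstrophy is infinite. [cite: FMRTTurbulence2001, Ch. V §1] -/
def ensembleDissipation (ν : ℝ) (μ : Measure (FunctionSpaces.Torus.energySpace d)) : ℝ :=
  ν * (ensembleEnstrophy μ).toReal

omit [DecidableEq d] in
/-- `μ` is a **time-average measure** of the trajectory `u : ℝ → H` with respect to the averaging
functional `avg : (ℝ → ℝ) → ℝ` (e.g. a Banach generalized limit of the time means
`T⁻¹ ∫₀ᵀ`, `Λ.longTimeAvg` of `Literature.Statements.Turb.Wave0`): `μ` is a probability measure and
`∫ Ψ dμ = avg (t ↦ Ψ(u(t)))` for every bounded continuous observable `Ψ : H → ℝ`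
(FMRT 2001, Ch. IV §2.1 Def. 2.1, §3.1 (3.1); generalized limits §1.3 Def. 1.4; Ch. V §1.2). The functional `avg` is applied to
bounded continuous observables only.
[cite: FMRTTurbulence2001, Ch. IV §2.1 Def. 2.1 (2.2) (d = 2) and §3.1 (3.1), Prop. 3.1 (d = 3); generalized limits §1.3 Def. 1.4] -/
def IsTimeAverageMeasure (avg : (ℝ → ℝ) → ℝ) (u : ℝ → FunctionSpaces.Torus.energySpace d)
    (μ : Measure (FunctionSpaces.Torus.energySpace d)) : Prop :=
  IsProbabilityMeasure μ ∧
    ∀ Ψ : FunctionSpaces.Torus.energySpace d → ℝ, Continuous Ψ → Bornology.IsBounded (Set.range Ψ) →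
      ∫ v, Ψ v ∂μ = avg (fun t => Ψ (u t))

/-- `u ∈ H` is a **steady weak solution** of the space-periodic Navier–Stokes equations with
viscosity `ν` and force `f`: `⟨F(u), w⟩ = (f, w) + ν (u, Δw) + ∫ (u ⊗ u) : ∇w = 0` for every
smooth divergence-free mean-zero test field `w ∈ 𝒱` (FMRT 2001, Ch. II §7 (7.1)–(7.2), Ch. IV
Rem. after Def. 1.2: Dirac measures at steady states are stationary statistical solutions).
Regularity `u ∈ V` is *not* part of the predicate; theorems add it.
[cite: FMRTTurbulence2001, Ch. II §7 and Ch. IV §1.1 (1.7), (1.11) (weak formulation)] -/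
def IsSteadyWeakSolution (ν : ℝ) (f : UnitAddTorus d → EuclideanSpace ℝ d) (u : FunctionSpaces.Torus.energySpace d) :
    Prop :=
  ∀ w : UnitAddTorus d → EuclideanSpace ℝ d, FunctionSpaces.Torus.IsSmooth w → FunctionSpaces.Torus.IsDivFree w → FunctionSpaces.Torus.HasZeroMean w →
    nsGeneratorPairing ν f u w = 0

/-! ### Basic properties (literature) -/

/-- Mean energy inequality of a stationary statistical solution: `ν ∫ ‖u‖_V² dμ ≤ ∫ (f, u) dμ`
(let `e₁ = 0`, `e₂ → ∞` in the shell energy inequality (1.31), using (1.29);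
FMRT 2001, Ch. IV §1.2, (1.31)–(1.33)).
[cite: FMRTTurbulence2001, Ch. IV §1.2 Def. 1.3, (1.29)–(1.31)] -/
def IsStationaryStatisticalSolution.energy_le : Prop :=
  ∀ {ν : ℝ} {f : UnitAddTorus d → EuclideanSpace ℝ d} {μ : Measure (FunctionSpaces.Torus.energySpace d)} (hμ : IsStationaryStatisticalSolution ν f μ) (hf : MemLp f 2 volume),
    ν * (ensembleEnstrophy μ).toReal ≤ ∫ u, pairing (u : L2T d) f ∂μ

/-- Mean energy **equation** of a stationary statistical solution in dimension two:
`ν ∫ ‖u‖_V² dμ = ∫ (f, u) dμ` (FMRT 2001, Ch. IV §2 / App. B.1; in `d = 2` the trilinear term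
`b(u, u, u)` is controlled by `|u| ‖u‖²`, so the Liouville equation (1.30) with
`Φ(u) = ψ(|P_m u|²)` passes to the limit and yields equality in (1.31)). Stated for
`Fintype.card d = 2` only; in `d = 3` only `energy_le` is known.
[cite: FMRTTurbulence2001, Ch. IV §1.2 (1.31)–(1.33)] -/
def IsStationaryStatisticalSolution.energy_eq : Prop :=
  ∀ {ν : ℝ} {f : UnitAddTorus d → EuclideanSpace ℝ d} {μ : Measure (FunctionSpaces.Torus.energySpace d)} (hd : Fintype.card d = 2) (hμ : IsStationaryStatisticalSolution ν f μ) (hf : MemLp f 2 volume),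
    ν * (ensembleEnstrophy μ).toReal = ∫ u, pairing (u : L2T d) f ∂μ

/-- The Dirac measure `δ_u` at a steady weak solution `u ∈ V` is a stationary statistical
solution (FMRT 2001, Ch. IV §1.2, discussion preceding Def. 1.3; Foias 1973). Hypotheses: `0 ≤ ν`,
`f ∈ L²`, `u ∈ V` (finite enstrophy) and `Fintype.card d ≤ 4`, so that by the Sobolev
embedding `H¹(T^d) ⊂ L⁴(T^d)` the weak formulation extends to test fields in `V` and
`b(u, u, u) = 0`, giving the energy equation `ν ‖u‖_V² = (f, u)` needed for (1.31).
[cite: FMRTTurbulence2001, Ch. IV §2 Thm. 2.2 with App. B.1 (d = 2: stationary statistical solutions are invariant measures; energy equation)] -/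
def isStationaryStatisticalSolution_dirac : Prop :=
  ∀ {ν : ℝ} (hν : 0 ≤ ν) {f : UnitAddTorus d → EuclideanSpace ℝ d} (hf : MemLp f 2 volume) (hd : Fintype.card d ≤ 4) {u : FunctionSpaces.Torus.energySpace d} (hV : (u : L2T d) ∈ FunctionSpaces.Torus.energySpaceV d) (hu : IsSteadyWeakSolution ν f u),
    IsStationaryStatisticalSolution ν f (Measure.dirac u)

/-- The mean energy dissipation rate of a stationary statistical solution is bounded by the
energy input: `ε(μ) = ν ∫ ‖∇u‖² dμ ≤ ‖f‖_{L²} (∫ |u|² dμ)^{1/2}` (from `energy_le` and the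
Cauchy–Schwarz inequality, `(f, u) ≤ ‖f‖ |u|`; FMRT 2001, Ch. IV (1.31)–(1.34);
Doering–Foias 2002, §2). Requires the mean energy `∫ |u|² dμ` to be finite.
[cite: FMRTTurbulence2001, Ch. IV §1.2 (1.31)–(1.33)] -/
def ensembleDissipation_le_of_isStationary : Prop :=
  ∀ {ν : ℝ} {f : UnitAddTorus d → EuclideanSpace ℝ d} {μ : Measure (FunctionSpaces.Torus.energySpace d)} (hμ : IsStationaryStatisticalSolution ν f μ) (hf : MemLp f 2 volume) (hE : Integrable (fun u : FunctionSpaces.Torus.energySpace d => ‖u‖ ^ 2) μ),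
    ensembleDissipation ν μ ≤
      Real.sqrt (∫ x, ‖f x‖ ^ 2) * Real.sqrt (ensembleEnergy μ)

end Torus

end Literature.Analysis.FluidPDE
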